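import Summits.HubbardSuperconductivity.HubbardSuperconductivity.Theorems.BalabanIRBirComplexStableXYRStubPathCfgD0
import HarnessLib

/-!
# Crux `BirComplexStableXYR`, line `fat-gaussian-defect-calculus`: stub C8 `stub_linearPartSector`

Registered stub (lead c7, skeleton `Cruxes/BirComplexStableXYR/Lines/fat_gaussian_defect_calculus.lean`), helper
(`--supports`) for the crux `Summit.HubbardSuperconductivity.HubbardSuperconductivity.Theses.BalabanIR.BirComplexStableXYR`:
**the linear part of the window weights only sees the sector.**

**Statement.** On the engine's torus `Λ L M = (Fin 2 → ZMod L) × ZMod M` with the space–time chart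
`F = TorusChart.piProdZMod 2 L M` (directions `0, 1` spatial, `2` temporal), let `P ω s w` be the window path
configuration of a real `1`-cochain `ω` (the staircase sum of `ω` from the corner `s`: `w.1` edges in direction `0`,
then `w.2.1` in direction `1`, then `w.2.2` in direction `2`; hypothesis `hP`).  Then for any site weights
`m : W r → ℝ`, any spin wave `φ` and any strain `σ`,
`Σ_s Σ_w m w · P (d₀φ − σ) s w = − Σ_s Σ_w m w · P σ s w`:
the translate-sum over all windows of the linear functional `u ↦ Σ_w m_w u_w` does not see the exact part.

**Proof.** Line sums are additive, so `P (d₀φ − σ) s w = P (d₀φ) s w − P σ s w`; the three lines of `d₀φ` telescope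
(`TorusChart.lineSum_d₀`) and the staircase ends at `sh L M s w` (landed `staircase_endpoint_eq_sh`), so
`P (d₀φ) s w = φ (sh L M s w) − φ s`.  Finally `s ↦ sh L M s w = s + δ_w` is a translation of the finite torus, hence
`Σ_s φ (sh L M s w) = Σ_s φ s` (`Equiv.sum_comp (Equiv.addRight δ_w)`) and the exact part sums to zero window by
window.  Elementary; no definition and no named fact is introduced; sorry-free. [folklore]
-/

set_option linter.dupNamespace false -- `Summit.<S>.<S>.Theorems…` repeats the summit name (D-0017 layout)

namespace Summit.HubbardSuperconductivity.HubbardSuperconductivity.Theorems.FSUnfolding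

open scoped BigOperators
open Literature.MathematicalPhysics.QuantumFieldTheory Literature.Probability.LatticeModels
open Summit.HubbardSuperconductivity.BirComplexStableXYNegative

/-- **One line of a gradient minus a strain** (any charted torus).  The line sum of `d₀φ − σ` along `n` edges in
direction `i` from `y` is `φ (y + n • e_i) − φ y −` (line sum of `σ`): additivity `lineSum_sub` and the telescoping
`lineSum_d₀`. [folklore] -/
theorem linearPartSector_lineSum_d₀_sub {Λ : Type*} [AddCommGroup Λ] {d : ℕ} (F : TorusChart Λ d)
    (φ : Λ → ℝ) (σ : Λ → Fin d → ℝ) (i : Fin d) (n : ℕ) (y : Λ) :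
    F.lineSum (fun x j => F.d₀ φ x j - σ x j) i n y = φ (y + n • F.gen i) - φ y - F.lineSum σ i n y := by
  have h1 : (fun x j => F.d₀ φ x j - σ x j) = F.d₀ φ - σ := rfl
  rw [h1, F.lineSum_sub, F.lineSum_d₀]

/-- **The window staircase of `d₀φ − σ`** on the engine's torus: it equals `φ (sh L M s w) − φ s` minus the
staircase of `σ` (three telescoping lines, endpoint `staircase_endpoint_eq_sh`). [folklore] -/
theorem linearPartSector_staircase (r L M : ℕ) [NeZero L] [NeZero M] (φ : Λ L M → ℝ)
    (σ : Λ L M → Fin 3 → ℝ) (s : Λ L M) (w : W r) :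
    (TorusChart.piProdZMod 2 L M).lineSum
        (fun x i => (TorusChart.piProdZMod 2 L M).d₀ φ x i - σ x i) 0 (w.1 : ℕ) s
      + (TorusChart.piProdZMod 2 L M).lineSum
        (fun x i => (TorusChart.piProdZMod 2 L M).d₀ φ x i - σ x i) 1 (w.2.1 : ℕ)
          (s + (w.1 : ℕ) • (TorusChart.piProdZMod 2 L M).gen 0)
      + (TorusChart.piProdZMod 2 L M).lineSum
        (fun x i => (TorusChart.piProdZMod 2 L M).d₀ φ x i - σ x i) 2 (w.2.2 : ℕ)
          (s + (w.1 : ℕ) • (TorusChart.piProdZMod 2 L M).gen 0 + (w.2.1 : ℕ) • (TorusChart.piProdZMod 2 L M).gen 1)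
      = φ (sh L M s w) - φ s -
        ((TorusChart.piProdZMod 2 L M).lineSum σ 0 (w.1 : ℕ) s
          + (TorusChart.piProdZMod 2 L M).lineSum σ 1 (w.2.1 : ℕ)
            (s + (w.1 : ℕ) • (TorusChart.piProdZMod 2 L M).gen 0)
          + (TorusChart.piProdZMod 2 L M).lineSum σ 2 (w.2.2 : ℕ)
            (s + (w.1 : ℕ) • (TorusChart.piProdZMod 2 L M).gen 0
              + (w.2.1 : ℕ) • (TorusChart.piProdZMod 2 L M).gen 1)) := by
  rw [linearPartSector_lineSum_d₀_sub, linearPartSector_lineSum_d₀_sub, linearPartSector_lineSum_d₀_sub,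
    staircase_endpoint_eq_sh r L M s w]
  ring

/-- **The window shift is a translation of the finite torus**, so translate-sums are shift invariant:
`Σ_s φ (sh L M s w) = Σ_s φ s` (`sh L M s w = s + (![w.1, w.2.1], w.2.2)` definitionally;
`Equiv.sum_comp (Equiv.addRight _)`). [folklore] -/
theorem linearPartSector_sum_sh (r L M : ℕ) [NeZero L] [NeZero M] (φ : Λ L M → ℝ) (w : W r) :
    ∑ s : Λ L M, φ (sh L M s w) = ∑ s : Λ L M, φ s := by
  have hsh : ∀ s : Λ L M, sh L M s w =
      s + (![((w.1 : ℕ) : ZMod L), ((w.2.1 : ℕ) : ZMod L)], ((w.2.2 : ℕ) : ZMod M)) := fun s => rfl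
  simp_rw [hsh]
  exact Equiv.sum_comp (Equiv.addRight _) φ

/-- **Stub C8 `stub_linearPartSector` (registered signature, verbatim): the linear part of the window weights only
sees the sector.**  For any site weights `m : W r → ℝ`, the translate-sum over all windows of the linear functional
`u ↦ Σ_w m_w u_w` evaluated on the window path configurations of `d₀φ − σ` does not depend on the spin wave `φ`:
the exact part drops out (`P_s(d₀φ) w = φ(sh s w) − φ s`, and `s ↦ sh s w` is a translation of the torus), so
`Σ_s Σ_w m w · P (d₀φ − σ) s w = −Σ_s Σ_w m w · P σ s w`.  Hence `Π_s e^{−iK m·P_s(d₀ψ − σ_a)} = e^{+iK Σ_s m·P_s σ_a}`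
is a sector constant (the Berry phase of the vortex/holonomy configuration), which chapter 2 factors out of every
sector integral. [folklore] -/
theorem stub_linearPartSector :
    ∀ (r L M : ℕ) [NeZero L] [NeZero M]
      (P : (Λ L M → Fin 3 → ℝ) → Λ L M → W r → ℝ),
      (∀ (ω : Λ L M → Fin 3 → ℝ) (s : Λ L M) (w : W r), P ω s w =
        (TorusChart.piProdZMod 2 L M).lineSum ω 0 (w.1 : ℕ) s
          + (TorusChart.piProdZMod 2 L M).lineSum ω 1 (w.2.1 : ℕ) (s + (w.1 : ℕ) • (TorusChart.piProdZMod 2 L M).gen 0)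
          + (TorusChart.piProdZMod 2 L M).lineSum ω 2 (w.2.2 : ℕ)
            (s + (w.1 : ℕ) • (TorusChart.piProdZMod 2 L M).gen 0 + (w.2.1 : ℕ) • (TorusChart.piProdZMod 2 L M).gen 1)) →
      ∀ (m : W r → ℝ) (φ : Λ L M → ℝ) (σ : Λ L M → Fin 3 → ℝ),
        ∑ s : Λ L M, ∑ w : W r, m w * P (fun x i => (TorusChart.piProdZMod 2 L M).d₀ φ x i - σ x i) s w =
          -∑ s : Λ L M, ∑ w : W r, m w * P σ s w := by
  intro r L M _ _ P hP m φ σ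
  -- (1)+(2): additivity of the staircase and telescoping of the exact part
  have hsub : ∀ (s : Λ L M) (w : W r),
      P (fun x i => (TorusChart.piProdZMod 2 L M).d₀ φ x i - σ x i) s w = φ (sh L M s w) - φ s - P σ s w := by
    intro s w
    rw [hP, hP, linearPartSector_staircase]
  -- (3): the exact part sums to zero window by window (translation invariance of the site sum)
  have hzero : ∑ s : Λ L M, ∑ w : W r, m w * (φ (sh L M s w) - φ s) = 0 := by
    rw [Finset.sum_comm]
    refine Finset.sum_eq_zero fun w _ => ?_
    rw [← Finset.mul_sum, Finset.sum_sub_distrib, linearPartSector_sum_sh r L M φ w, sub_self, mul_zero]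
  -- (4): assemble
  have hsplit : ∑ s : Λ L M, ∑ w : W r, m w * P (fun x i => (TorusChart.piProdZMod 2 L M).d₀ φ x i - σ x i) s w
      = ∑ s : Λ L M, ∑ w : W r, m w * (φ (sh L M s w) - φ s) - ∑ s : Λ L M, ∑ w : W r, m w * P σ s w := by
    rw [← Finset.sum_sub_distrib]
    refine Finset.sum_congr rfl fun s _ => ?_
    rw [← Finset.sum_sub_distrib]
    refine Finset.sum_congr rfl fun w _ => ?_
    rw [hsub, mul_sub]
  rw [hsplit, hzero, zero_sub]

end Summit.HubbardSuperconductivity.HubbardSuperconductivity.Theorems.FSUnfolding
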